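import Literature.Probability.RandomPlanarGeometry.CritPercSLESpaceFillingFromTraceInputs
import Literature.Probability.RandomPlanarGeometry.SLETransienceKappaEightHolds
import HarnessLib

/-!
# The space-filling phase of SLE (Rohde–Schramm (2005), Cor. 7.4): unconditional forms

Topic `Probability/RandomPlanarGeometry`; theorems only (no definition, no new named fact).
Bookkeeping on the named fact
`Literature.Probability.RandomPlanarGeometry.ae_isSpaceFilling_sleTrace_of_eight_le`
(`CritPercSLE.lean`; S. Rohde, O. Schramm, *Basic properties of SLE*, Ann. of Math. 161 (2005),
Cor. 7.4, p. 911 / arXiv p. 18: "Suppose that `κ > 8`, then `γ[0, ∞) = ℍ̄` a.s.", with the Update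
following it: "Corollary 7.4 and Theorem 7.1 are true also for `κ = 8`. The proofs are based on the
extension [LSW] to `κ = 8` of Theorem 5.1, and are otherwise the same").

Rohde–Schramm's Corollary 3.5 is now a theorem of the tree (`RohdeSchramm2005_cor35_holds`,
`RohdeSchrammCor35Proofs.lean`), hence so are Thm. 5.1 (`hasSLETrace_of_ne_eight_holds`), Thm. 7.1
for `κ ≠ 8` (`tendsto_norm_sleTrace_atTop_of_ne_eight`) and Thm. 7.1 at `κ = 8` given the SLE₈
trace (`RohdeSchramm2005_thm71_eight_holds`). Feeding `RohdeSchramm2005_cor35_holds` into the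
conditional assembly of `CritPercSLESpaceFillingFromTraceInputs.lean` (dense by Lemma 6.3 and
(6.2), `tendsto_sleDerivRatio_atTop_of_eight_le_holds`; closed by transience) gives the exact
status of Cor. 7.4 in the tree:

* `ae_isSpaceFilling_sleTrace_of_eight_lt_apply`, `ae_range_sleTrace_eq_closure_of_eight_lt`,
  `ae_forall_exists_sleTrace_eq_of_eight_lt` — **Cor. 7.4 as printed, unconditionally**: for
  every `κ > 8`, almost surely `γ[0, ∞) = ℍ̄` (every point of the closed half-plane is visited).
* `ae_isSpaceFilling_sleTrace_of_hasSLETrace_apply` — **Cor. 7.4 with the Update in its printed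
  (conditional at `κ = 8`) form**: for `κ ≥ 8`, if SLE_κ is generated by a curve then a.s.
  `γ[0, ∞) = ℍ̄`; and `ae_isSpaceFilling_sleTrace_iff_hasSLETrace` — for `κ ≥ 8` the trace of
  the tree (`sleTrace`, junk constant path when the chain is not generated by a curve) is a.s.
  space-filling **iff** SLE_κ is a.s. generated by a curve.
* `ae_isSpaceFilling_sleTrace_of_eight_le_of_ne_eight` — the named fact at every `κ ≠ 8`,
  unconditionally; `ae_isSpaceFilling_sleTrace_of_eight_le_of_hasSLETrace_eight` — the named fact
  (every `κ`) from Lawler–Schramm–Werner's Thm. 4.7 **alone** (`hasSLETrace_eight`: SLE₈ is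
  generated by a curve); `ae_isSpaceFilling_sleTrace_of_eight_le_eight_iff`,
  `forall_ae_isSpaceFilling_sleTrace_of_eight_le_iff` — the named fact (at `κ = 8`, resp. at every
  `κ`) is **equivalent** to `hasSLETrace_eight`, to the transience fact
  `tendsto_norm_sleTrace_atTop` (`…_iff_tendsto_norm_sleTrace_atTop`) and to `exists_isSLECurve`
  (`…_iff_exists_isSLECurve`); `ae_isSpaceFilling_sleTrace_eight_iff_ae_tendsto_norm_atTop` — at
  `κ = 8`, a.s. space-filling iff a.s. transient.

So the one input still owed for the discharge `ae_isSpaceFilling_sleTrace_of_eight_le_holds` is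
exactly [LSW04] Thm. 4.7 (`hasSLETrace_eight`; in the tree reduced to
`USTPeano.drivingProcess_tendsto` = [LSW04] Thm. 4.4 and Prop. 4.5 by
`USTPeano.hasSLETrace_eight_of_LSW`), and no proof can avoid it: the named fact at `κ = 8` implies
it outright (`hasSLETrace_of_ae_isSpaceFilling_sleTrace_of_eight_le`). The discharge will be
`ae_isSpaceFilling_sleTrace_of_eight_le_of_hasSLETrace_eight hasSLETrace_eight_holds`.

## References

* S. Rohde, O. Schramm, *Basic properties of SLE*, Ann. of Math. 161 (2005) 883–924
  (arXiv:math/0106036): Cor. 3.5, Thm. 5.1, Lemma 6.3, Thm. 7.1, Cor. 7.4 and the Update (p. 911).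
* G. F. Lawler, O. Schramm, W. Werner, *Conformal invariance of planar loop-erased random walks
  and uniform spanning trees*, Ann. Probab. 32 (2004) 939–995, Thm. 4.7.
-/

noncomputable section

open Filter MeasureTheory Set
open UpperHalfPlane (upperHalfPlaneSet)
open scoped NNReal

namespace Literature.Probability.RandomPlanarGeometry

open Loewner

variable {κ : ℝ≥0}

/-! ### Cor. 7.4 with the Update, printed (conditional) form, every `κ ≥ 8` -/

/-- **Rohde–Schramm (2005), Cor. 7.4 with the Update, in its printed form, for every `κ ≥ 8`,
unconditionally**: if SLE_κ is a.s. generated by a curve then almost surely `γ[0, ∞) = ℍ̄`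
(`ae_isSpaceFilling_sleTrace_of_cor35_of_hasSLETrace` fed with `RohdeSchramm2005_cor35_holds`:
dense by Lemma 6.3 and (6.2), closed by Thm. 7.1). For `κ > 8` the hypothesis is Thm. 5.1
(`hasSLETrace_of_ne_eight_apply`); at `κ = 8` it is [LSW] Thm. 4.7 (`hasSLETrace_eight`).
[cite: RohdeSchramm2005, Cor. 7.4 and Update (p. 911)] -/
theorem ae_isSpaceFilling_sleTrace_of_hasSLETrace_apply (hκ : 8 ≤ κ) (h0 : HasSLETrace κ) :
    ∀ᵐ ω ∂Process.preWienerMeasure, IsSpaceFilling (sleTrace κ ω) :=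
  ae_isSpaceFilling_sleTrace_of_cor35_of_hasSLETrace (RohdeSchramm2005_cor35_holds _) hκ h0

/-- **For `κ ≥ 8`, unconditionally: a.s. `γ[0, ∞) = ℍ̄` iff SLE_κ is a.s. generated by a curve.**
`→` is `hasSLETrace_of_ae_isSpaceFilling_sleTrace` (the junk trace of a chain not generated by a
curve is constant, hence not space-filling); `←` is `ae_isSpaceFilling_sleTrace_of_hasSLETrace_apply`.
[cite: RohdeSchramm2005, Cor. 7.4 and Update (p. 911)] -/
theorem ae_isSpaceFilling_sleTrace_iff_hasSLETrace (hκ : 8 ≤ κ) :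
    (∀ᵐ ω ∂Process.preWienerMeasure, IsSpaceFilling (sleTrace κ ω)) ↔ HasSLETrace κ :=
  ae_isSpaceFilling_sleTrace_iff_hasSLETrace_of_cor35 (RohdeSchramm2005_cor35_holds _) hκ

/-! ### Cor. 7.4 as printed (`κ > 8`), unconditionally -/

/-- **Rohde–Schramm (2005), Cor. 7.4, as printed, unconditionally**: "Suppose that `κ > 8`, then
`γ[0, ∞) = ℍ̄` a.s." — the SLE_κ trace is almost surely space-filling. The trace exists by
Thm. 5.1 (`hasSLETrace_of_ne_eight_holds`, from Cor. 3.5 `RohdeSchramm2005_cor35_holds`); it is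
a.s. dense in `ℍ` by Lemma 6.3 with (6.2) (`tendsto_sleDerivRatio_atTop_of_eight_le_holds`) and
a.s. closed by transience, Thm. 7.1 (`tendsto_norm_sleTrace_atTop_of_ne_eight`). No input from
Lawler–Schramm–Werner (2004) is involved in this range. [cite: RohdeSchramm2005, Cor. 7.4] -/
theorem ae_isSpaceFilling_sleTrace_of_eight_lt_apply (hκ : 8 < κ) :
    ∀ᵐ ω ∂Process.preWienerMeasure, IsSpaceFilling (sleTrace κ ω) :=
  ae_isSpaceFilling_sleTrace_of_cor35_of_eight_lt (RohdeSchramm2005_cor35_holds _) hκ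

/-- **Cor. 7.4 as printed, range form**: for `κ > 8`, almost surely
`γ[0, ∞) = closure ℍ`. [cite: RohdeSchramm2005, Cor. 7.4] -/
theorem ae_range_sleTrace_eq_closure_of_eight_lt (hκ : 8 < κ) :
    ∀ᵐ ω ∂Process.preWienerMeasure, range (sleTrace κ ω) = closure upperHalfPlaneSet :=
  ae_isSpaceFilling_sleTrace_of_eight_lt_apply hκ

/-- **Cor. 7.4 as printed, pointwise form**: for `κ > 8`, almost surely the SLE_κ trace visits
every point of the closed upper half-plane. [cite: RohdeSchramm2005, Cor. 7.4] -/
theorem ae_forall_exists_sleTrace_eq_of_eight_lt (hκ : 8 < κ) :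
    ∀ᵐ ω ∂Process.preWienerMeasure, ∀ z : ℂ, 0 ≤ z.im → ∃ t, sleTrace κ ω t = z := by
  filter_upwards [ae_range_sleTrace_eq_closure_of_eight_lt hκ] with ω hω z hz
  have hz' : z ∈ closure upperHalfPlaneSet := by
    rw [show closure upperHalfPlaneSet = {z : ℂ | 0 ≤ z.im} from Complex.closure_setOf_lt_im 0]
    exact hz
  rw [← hω] at hz'
  exact hz'

/-- **The named fact `ae_isSpaceFilling_sleTrace_of_eight_le` at every `κ ≠ 8`, unconditionally**
(vacuous for `κ < 8`; Cor. 7.4 as printed for `κ > 8`). [cite: RohdeSchramm2005, Cor. 7.4] -/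
theorem ae_isSpaceFilling_sleTrace_of_eight_le_of_ne_eight (hκ8 : κ ≠ 8) :
    ae_isSpaceFilling_sleTrace_of_eight_le (κ := κ) :=
  ae_isSpaceFilling_sleTrace_of_eight_le_of_cor35_of_ne_eight (RohdeSchramm2005_cor35_holds _) hκ8

/-! ### The named fact and [LSW] Thm. 4.7 -/

/-- **`ae_isSpaceFilling_sleTrace_of_eight_le` (every `κ`) from Lawler–Schramm–Werner's Thm. 4.7
alone** (`hasSLETrace_eight`: SLE₈ is generated by a curve): Thm. 7.1 with the Update from
Cor. 3.5 (`RohdeSchramm2005_cor35_holds`) and the SLE₈ trace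
(`tendsto_norm_sleTrace_atTop_of_hasSLETrace_eight`), then Cor. 7.4 from transience
(`ae_isSpaceFilling_sleTrace_of_eight_le_of_tendsto_norm_sleTrace_atTop`). This is the term the
discharge `ae_isSpaceFilling_sleTrace_of_eight_le_holds` will apply to `hasSLETrace_eight_holds`.
[cite: RohdeSchramm2005, Cor. 7.4 and Update (p. 911); LawlerSchrammWerner2004, Thm 4.7] -/
theorem ae_isSpaceFilling_sleTrace_of_eight_le_of_hasSLETrace_eight (h8e : hasSLETrace_eight) :
    ae_isSpaceFilling_sleTrace_of_eight_le (κ := κ) :=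
  ae_isSpaceFilling_sleTrace_of_eight_le_of_cor35_of_hasSLETrace_eight
    (RohdeSchramm2005_cor35_holds _) h8e

/-- **The named fact at `κ = 8` is equivalent to the SLE₈ trace theorem** `hasSLETrace_eight`
([LSW] Thm. 4.7), unconditionally: `→` is `hasSLETrace_of_ae_isSpaceFilling_sleTrace_of_eight_le`,
`←` is `ae_isSpaceFilling_sleTrace_of_eight_le_of_hasSLETrace_eight`.
[cite: RohdeSchramm2005, Cor. 7.4 and Update (p. 911)] -/
theorem ae_isSpaceFilling_sleTrace_of_eight_le_eight_iff :
    ae_isSpaceFilling_sleTrace_of_eight_le (κ := 8) ↔ hasSLETrace_eight :=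
  ae_isSpaceFilling_sleTrace_of_eight_le_eight_iff_of_cor35 (RohdeSchramm2005_cor35_holds _)

/-- **The named fact at every `κ` is equivalent to `hasSLETrace_eight`**, unconditionally: its
instances at `κ ≠ 8` are theorems (`ae_isSpaceFilling_sleTrace_of_eight_le_of_ne_eight`).
[cite: RohdeSchramm2005, Cor. 7.4 and Update (p. 911)] -/
theorem forall_ae_isSpaceFilling_sleTrace_of_eight_le_iff :
    (∀ κ : ℝ≥0, ae_isSpaceFilling_sleTrace_of_eight_le (κ := κ)) ↔ hasSLETrace_eight :=
  forall_ae_isSpaceFilling_sleTrace_of_eight_le_iff_of_cor35 (RohdeSchramm2005_cor35_holds _)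

/-- **The named fact at every `κ` reduces to its instance at `κ = 8`.**
[cite: RohdeSchramm2005, Cor. 7.4 and Update (p. 911)] -/
theorem forall_ae_isSpaceFilling_sleTrace_of_eight_le_iff_eight :
    (∀ κ : ℝ≥0, ae_isSpaceFilling_sleTrace_of_eight_le (κ := κ)) ↔
      ae_isSpaceFilling_sleTrace_of_eight_le (κ := 8) :=
  forall_ae_isSpaceFilling_sleTrace_of_eight_le_iff.trans
    ae_isSpaceFilling_sleTrace_of_eight_le_eight_iff.symm

/-- **The named fact at every `κ` is equivalent to the transience fact**
`tendsto_norm_sleTrace_atTop` (Thm. 7.1 with the Update, every `κ > 0`), unconditionally.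
[cite: RohdeSchramm2005, Cor. 7.4, Thm 7.1 and Update (p. 911)] -/
theorem forall_ae_isSpaceFilling_sleTrace_of_eight_le_iff_tendsto_norm_sleTrace_atTop :
    (∀ κ : ℝ≥0, ae_isSpaceFilling_sleTrace_of_eight_le (κ := κ)) ↔ tendsto_norm_sleTrace_atTop :=
  forall_ae_isSpaceFilling_sleTrace_of_eight_le_iff_tendsto_norm_sleTrace_atTop_of_cor35
    (RohdeSchramm2005_cor35_holds _)

/-- **The named fact at every `κ` is equivalent to the existence of the chordal SLE_κ curves in
every Dobrushin domain** (`exists_isSLECurve`), unconditionally.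
[cite: RohdeSchramm2005, Cor. 7.4, Thm 5.1 and Update (p. 911)] -/
theorem forall_ae_isSpaceFilling_sleTrace_of_eight_le_iff_exists_isSLECurve :
    (∀ κ : ℝ≥0, ae_isSpaceFilling_sleTrace_of_eight_le (κ := κ)) ↔ exists_isSLECurve :=
  forall_ae_isSpaceFilling_sleTrace_of_eight_le_iff_exists_isSLECurve_of_cor35
    (RohdeSchramm2005_cor35_holds _)

/-- **At `κ = 8`, unconditionally: the SLE₈ trace of the tree is a.s. space-filling iff it is a.s.
transient.** `→`: a.s. space-filling forces the chain to be generated by a curve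
(`hasSLETrace_of_ae_isSpaceFilling_sleTrace`), and then Thm. 7.1 at `κ = 8`
(`RohdeSchramm2005_thm71_eight_holds`); `←` is Cor. 7.4 at `κ = 8` from transience
(`ae_isSpaceFilling_sleTrace_eight_of_ae_tendsto_norm_atTop`).
[cite: RohdeSchramm2005, Cor. 7.4, Thm 7.1 and Update (p. 911)] -/
theorem ae_isSpaceFilling_sleTrace_eight_iff_ae_tendsto_norm_atTop :
    (∀ᵐ ω ∂Process.preWienerMeasure, IsSpaceFilling (sleTrace 8 ω)) ↔
      ∀ᵐ ω ∂Process.preWienerMeasure, Tendsto (fun t ↦ ‖sleTrace 8 ω t‖) atTop atTop :=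
  ⟨fun h ↦ RohdeSchramm2005_thm71_eight_holds (hasSLETrace_of_ae_isSpaceFilling_sleTrace h),
    ae_isSpaceFilling_sleTrace_eight_of_ae_tendsto_norm_atTop⟩

end Literature.Probability.RandomPlanarGeometry

end
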